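import Literature.Combinatorics.SimpleGraph.TreewidthBrambleLowerBound
import HarnessLib

/-!
# The tree-width of the three-dimensional grid is at least `m² / 16` (theorem-only file)

For the `m × m × m` grid `P_m □ (P_m □ P_m)` (`m = k + 1`, vertices
`Fin m × Fin m × Fin m`) we prove `tw ≥ w` whenever `16 w ≤ m²`
(`le_treewidth_cubeGrid`, `sq_div_sixteen_le_treewidth_cubeGrid`).

Method (the isoperimetric / balanced-separator method, cf.
[SunilchandranKavitha2006, §4 Lemma 7: `tw(G) ≥ min_{n/4 ≤ s ≤ n/2} b_v(s, G) − 1`], run through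
brambles): the connected vertex sets with more than half of the vertices form a bramble
(any two of them meet), so by the easy direction of tree-width duality
(`le_treewidth_of_isBramble`, [Diestel2010, Thm 12.3.6]) it suffices that deleting any `w`
vertices with `16 w ≤ m²` leaves a connected set of more than `m³ / 2` vertices
(`exists_isConnectedSet_disjoint_cubeGrid`). The latter is an elementary FREE-LINE COUNT (ours):
call an axis-parallel line free if it misses the deleted set `X`; at most `|X|` lines of each
direction are not free; a row index `y` is good if some `x`-parallel line `(·, y, c)` is free and
sparse if fewer than `m/4` of the `z`-parallel lines `(x, y, ·)` are not free; all free
`z`-parallel lines in good sparse rows are mutually joined by walks avoiding `X` (inside a row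
through its free `x`-line; between two such rows through a column index `x₀` whose `y`-parallel
line `(x₀, ·, c')` is free and whose `z`-lines in both rows are free — such `x₀` exists by
counting), and they carry more than `m³ − m|X| − 5m|X| ≥ 10 m³/16 > m³/2` vertices.

## References
* [SunilchandranKavitha2006] L. S. Chandran, T. Kavitha, The treewidth and pathwidth of
  hypercubes, Discrete Math. 306 (2006) 359–365, §4 (Lemma 7: the isoperimetric lower bound).
* [Diestel2010] R. Diestel, Graph Theory, 4th ed., GTM 173, Thm 12.3.6.
-/

open scoped Classical

namespace Literature.Combinatorics.SimpleGraph

open _root_.SimpleGraph Finset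

section CubeGrid

variable {k : ℕ}

/-! ### Walks along axis-parallel lines -/

/-- Lifting a walk of the first factor to a box product (second coordinate fixed), with control
of the support. [folklore] -/
private theorem exists_walk_boxProd_fst {α β : Type*} (G₁ : _root_.SimpleGraph α)
    (G₂ : _root_.SimpleGraph β) (b : β) : ∀ {a a' : α} (_ : G₁.Walk a a'),
      ∃ W' : (G₁ □ G₂).Walk (a, b) (a', b), ∀ p ∈ W'.support, p.2 = b
  | _, _, Walk.nil => ⟨Walk.nil, fun p hp => by simp at hp; simp [hp]⟩
  | a, _, Walk.cons (v := c) h W => by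
    obtain ⟨W', hW'⟩ := exists_walk_boxProd_fst G₁ G₂ b W
    have hadj : (G₁ □ G₂).Adj (a, b) (c, b) := by rw [boxProd_adj]; exact Or.inl ⟨h, rfl⟩
    refine ⟨Walk.cons hadj W', fun p hp => ?_⟩
    rw [Walk.support_cons, List.mem_cons] at hp
    rcases hp with rfl | hp
    · rfl
    · exact hW' p hp

/-- Lifting a walk of the second factor to a box product (first coordinate fixed), with control
of the support. [folklore] -/
private theorem exists_walk_boxProd_snd {α β : Type*} (G₁ : _root_.SimpleGraph α)
    (G₂ : _root_.SimpleGraph β) (a : α) : ∀ {b b' : β} (W : G₂.Walk b b'),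
      ∃ W' : (G₁ □ G₂).Walk (a, b) (a, b'), ∀ p ∈ W'.support, p.1 = a ∧ p.2 ∈ W.support
  | b, _, Walk.nil => ⟨Walk.nil, fun p hp => by simp at hp; simp [hp]⟩
  | b, _, Walk.cons (v := c) h W => by
    obtain ⟨W', hW'⟩ := exists_walk_boxProd_snd G₁ G₂ a W
    have hadj : (G₁ □ G₂).Adj (a, b) (a, c) := by rw [boxProd_adj]; exact Or.inr ⟨h, rfl⟩
    refine ⟨Walk.cons hadj W', fun p hp => ?_⟩
    rw [Walk.support_cons, List.mem_cons] at hp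
    rcases hp with rfl | hp
    · exact ⟨rfl, by simp⟩
    · exact ⟨(hW' p hp).1, by simp [(hW' p hp).2]⟩

/-- A walk along an `x`-parallel line of the cube grid. [folklore] -/
private theorem exists_walk_xline (yz : Fin (k + 1) × Fin (k + 1)) (t t' : Fin (k + 1)) :
    ∃ W : (pathGraph (k + 1) □ (pathGraph (k + 1) □ pathGraph (k + 1))).Walk (t, yz) (t', yz),
      ∀ p ∈ W.support, p.2 = yz := by
  obtain ⟨W₁⟩ := (pathGraph_connected k).preconnected t t'
  exact exists_walk_boxProd_fst (pathGraph (k + 1)) (pathGraph (k + 1) □ pathGraph (k + 1)) yz W₁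

/-- A walk along a `y`-parallel line of the cube grid. [folklore] -/
private theorem exists_walk_yline (x z t t' : Fin (k + 1)) :
    ∃ W : (pathGraph (k + 1) □ (pathGraph (k + 1) □ pathGraph (k + 1))).Walk (x, (t, z)) (x, (t', z)),
      ∀ p ∈ W.support, p.1 = x ∧ p.2.2 = z := by
  obtain ⟨W₁⟩ := (pathGraph_connected k).preconnected t t'
  obtain ⟨W₂, hW₂⟩ := exists_walk_boxProd_fst (pathGraph (k + 1)) (pathGraph (k + 1)) z W₁
  obtain ⟨W, hW⟩ :=
    exists_walk_boxProd_snd (pathGraph (k + 1)) (pathGraph (k + 1) □ pathGraph (k + 1)) x W₂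
  exact ⟨W, fun p hp => ⟨(hW p hp).1, hW₂ _ (hW p hp).2⟩⟩

/-- A walk along a `z`-parallel line of the cube grid. [folklore] -/
private theorem exists_walk_zline (x y t t' : Fin (k + 1)) :
    ∃ W : (pathGraph (k + 1) □ (pathGraph (k + 1) □ pathGraph (k + 1))).Walk (x, (y, t)) (x, (y, t')),
      ∀ p ∈ W.support, p.1 = x ∧ p.2.1 = y := by
  obtain ⟨W₁⟩ := (pathGraph_connected k).preconnected t t'
  obtain ⟨W₂, hW₂⟩ := exists_walk_boxProd_snd (pathGraph (k + 1)) (pathGraph (k + 1)) y W₁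
  obtain ⟨W, hW⟩ :=
    exists_walk_boxProd_snd (pathGraph (k + 1)) (pathGraph (k + 1) □ pathGraph (k + 1)) x W₂
  exact ⟨W, fun p hp => ⟨(hW p hp).1, (hW₂ _ (hW p hp).2).1⟩⟩

/-! ### Walks avoiding a vertex set -/

/-- Concatenating walks that avoid `X`. [folklore] -/
private theorem avoid_trans {V : Type*} {G : _root_.SimpleGraph V} {X : Finset V} {a b c : V}
    (h₁ : ∃ W : G.Walk a b, ∀ p ∈ W.support, p ∉ X)
    (h₂ : ∃ W : G.Walk b c, ∀ p ∈ W.support, p ∉ X) :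
    ∃ W : G.Walk a c, ∀ p ∈ W.support, p ∉ X := by
  obtain ⟨W₁, hW₁⟩ := h₁
  obtain ⟨W₂, hW₂⟩ := h₂
  refine ⟨W₁.append W₂, fun p hp => ?_⟩
  rw [Walk.mem_support_append_iff] at hp
  exact hp.elim (hW₁ p) (hW₂ p)

/-- Reversing a walk that avoids `X`. [folklore] -/
private theorem avoid_symm {V : Type*} {G : _root_.SimpleGraph V} {X : Finset V} {a b : V}
    (h : ∃ W : G.Walk a b, ∀ p ∈ W.support, p ∉ X) :
    ∃ W : G.Walk b a, ∀ p ∈ W.support, p ∉ X := by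
  obtain ⟨W, hW⟩ := h
  exact ⟨W.reverse, fun p hp => hW p (by rwa [Walk.support_reverse, List.mem_reverse] at hp)⟩

/-- Every vertex on a walk avoiding `X` is reached from the start avoiding `X`. [folklore] -/
private theorem avoid_of_mem_support {V : Type*} [DecidableEq V] {G : _root_.SimpleGraph V}
    {X : Finset V} {a b : V} (W : G.Walk a b) (hW : ∀ p ∈ W.support, p ∉ X) {c : V}
    (hc : c ∈ W.support) : ∃ W' : G.Walk a c, ∀ p ∈ W'.support, p ∉ X :=
  ⟨W.takeUntil c hc, fun p hp => hW p (W.support_takeUntil_subset_support hc hp)⟩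

/-- Moving along a free `z`-parallel line. [folklore] -/
private theorem reach_zline {X : Finset (Fin (k + 1) × Fin (k + 1) × Fin (k + 1))}
    {x y : Fin (k + 1)} (hfree : ∀ t, (x, (y, t)) ∉ X) (t t' : Fin (k + 1)) :
    ∃ W : (pathGraph (k + 1) □ (pathGraph (k + 1) □ pathGraph (k + 1))).Walk (x, (y, t)) (x, (y, t')),
      ∀ p ∈ W.support, p ∉ X := by
  obtain ⟨W, hW⟩ := exists_walk_zline x y t t'
  refine ⟨W, fun p hp => ?_⟩
  obtain ⟨px, py, pz⟩ := p
  obtain ⟨h1, h2⟩ := hW _ hp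
  simp only at h1 h2
  subst h1 h2
  exact hfree pz

/-- Moving along a free `x`-parallel line. [folklore] -/
private theorem reach_xline {X : Finset (Fin (k + 1) × Fin (k + 1) × Fin (k + 1))}
    {y z : Fin (k + 1)} (hfree : ∀ t, (t, (y, z)) ∉ X) (t t' : Fin (k + 1)) :
    ∃ W : (pathGraph (k + 1) □ (pathGraph (k + 1) □ pathGraph (k + 1))).Walk (t, (y, z)) (t', (y, z)),
      ∀ p ∈ W.support, p ∉ X := by
  obtain ⟨W, hW⟩ := exists_walk_xline (y, z) t t'
  refine ⟨W, fun p hp => ?_⟩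
  obtain ⟨px, pyz⟩ := p
  have h1 := hW _ hp
  simp only at h1
  subst h1
  exact hfree px

/-- Moving along a free `y`-parallel line. [folklore] -/
private theorem reach_yline {X : Finset (Fin (k + 1) × Fin (k + 1) × Fin (k + 1))}
    {x z : Fin (k + 1)} (hfree : ∀ t, (x, (t, z)) ∉ X) (t t' : Fin (k + 1)) :
    ∃ W : (pathGraph (k + 1) □ (pathGraph (k + 1) □ pathGraph (k + 1))).Walk (x, (t, z)) (x, (t', z)),
      ∀ p ∈ W.support, p ∉ X := by
  obtain ⟨W, hW⟩ := exists_walk_yline x z t t'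
  refine ⟨W, fun p hp => ?_⟩
  obtain ⟨px, py, pz⟩ := p
  obtain ⟨h1, h2⟩ := hW _ hp
  simp only at h1 h2
  subst h1 h2
  exact hfree py

/-- Inside a row `y` with a free `x`-line `(·, y, c)`, any two free `z`-lines are joined avoiding
`X`. [folklore] -/
private theorem reach_row {X : Finset (Fin (k + 1) × Fin (k + 1) × Fin (k + 1))}
    {x x' y c : Fin (k + 1)} (hz : ∀ t, (x, (y, t)) ∉ X) (hz' : ∀ t, (x', (y, t)) ∉ X)
    (hx : ∀ t, (t, (y, c)) ∉ X) (t t' : Fin (k + 1)) :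
    ∃ W : (pathGraph (k + 1) □ (pathGraph (k + 1) □ pathGraph (k + 1))).Walk (x, (y, t)) (x', (y, t')),
      ∀ p ∈ W.support, p ∉ X :=
  avoid_trans (reach_zline hz t c) (avoid_trans (reach_xline hx x x') (reach_zline hz' c t'))

/-- Inside a column index `x` with a free `y`-line `(x, ·, c)`, any two free `z`-lines are joined
avoiding `X`. [folklore] -/
private theorem reach_col {X : Finset (Fin (k + 1) × Fin (k + 1) × Fin (k + 1))}
    {x y y' c : Fin (k + 1)} (hz : ∀ t, (x, (y, t)) ∉ X) (hz' : ∀ t, (x, (y', t)) ∉ X)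
    (hy : ∀ t, (x, (t, c)) ∉ X) (t t' : Fin (k + 1)) :
    ∃ W : (pathGraph (k + 1) □ (pathGraph (k + 1) □ pathGraph (k + 1))).Walk (x, (y, t)) (x, (y', t')),
      ∀ p ∈ W.support, p ∉ X :=
  avoid_trans (reach_zline hz t c) (avoid_trans (reach_yline hy y y') (reach_zline hz' c t'))


/-! ### The free-line count -/

/-- **The core.** If `16 |X| ≤ m²` (`m = k + 1`), the vertices of the free `z`-parallel lines in
good sparse rows number more than `m³ / 2` and are mutually joined by walks avoiding `X`.
[folklore] -/
private theorem exists_core (X : Finset (Fin (k + 1) × Fin (k + 1) × Fin (k + 1)))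
    (hX : 16 * X.card ≤ (k + 1) ^ 2) :
    ∃ T : Finset (Fin (k + 1) × Fin (k + 1) × Fin (k + 1)), (k + 1) ^ 3 < 2 * T.card ∧
      ∀ v ∈ T, ∀ w ∈ T,
        ∃ W : (pathGraph (k + 1) □ (pathGraph (k + 1) □ pathGraph (k + 1))).Walk v w,
          ∀ p ∈ W.support, p ∉ X := by
  -- occupied (= not free) lines of the three directions
  set P : Finset (Fin (k + 1) × Fin (k + 1)) := X.image fun v => (v.1, v.2.1) with hP
  set Pyz : Finset (Fin (k + 1) × Fin (k + 1)) := X.image fun v => v.2 with hPyz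
  set Pxz : Finset (Fin (k + 1) × Fin (k + 1)) := X.image fun v => (v.1, v.2.2) with hPxz
  have hPc : P.card ≤ X.card := card_image_le
  have zfree_of : ∀ {x y}, (x, y) ∉ P → ∀ t, (x, (y, t)) ∉ X :=
    fun h t ht => h (mem_image.2 ⟨_, ht, rfl⟩)
  have xfree_of : ∀ {y z}, (y, z) ∉ Pyz → ∀ t, (t, (y, z)) ∉ X :=
    fun h t ht => h (mem_image.2 ⟨_, ht, rfl⟩)
  have yfree_of : ∀ {x z}, (x, z) ∉ Pxz → ∀ t, (x, (t, z)) ∉ X :=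
    fun h t ht => h (mem_image.2 ⟨_, ht, rfl⟩)
  -- bad row / column indices: no free `x`-line `(·, y, z)` / no free `y`-line `(x, ·, z)`
  set badY : Finset (Fin (k + 1)) := univ.filter fun y => ∀ z, (y, z) ∈ Pyz with hbadY
  set badX : Finset (Fin (k + 1)) := univ.filter fun x => ∀ z, (x, z) ∈ Pxz with hbadX
  have hbadYc : badY.card * (k + 1) ≤ X.card := by
    calc badY.card * (k + 1) = (badY ×ˢ (univ : Finset (Fin (k + 1)))).card := by
          rw [card_product, card_univ, Fintype.card_fin]
      _ ≤ Pyz.card := card_le_card fun p hp => by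
          rw [mem_product] at hp
          exact (mem_filter.1 hp.1).2 p.2
      _ ≤ X.card := card_image_le
  have hbadXc : badX.card * (k + 1) ≤ X.card := by
    calc badX.card * (k + 1) = (badX ×ˢ (univ : Finset (Fin (k + 1)))).card := by
          rw [card_product, card_univ, Fintype.card_fin]
      _ ≤ Pxz.card := card_le_card fun p hp => by
          rw [mem_product] at hp
          exact (mem_filter.1 hp.1).2 p.2
      _ ≤ X.card := card_image_le
  -- `N y` = number of occupied `z`-lines in row `y`; dense rows
  set N : Fin (k + 1) → ℕ := fun y => (P.filter fun p => p.2 = y).card with hN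
  have hsumN : ∑ y, N y = P.card :=
    (card_eq_sum_card_fiberwise (f := Prod.snd) (t := univ) fun p _ => mem_univ _).symm
  set dense : Finset (Fin (k + 1)) := univ.filter fun y => k + 1 ≤ 4 * N y with hdense
  have hdensec : dense.card * (k + 1) ≤ 4 * X.card := by
    calc dense.card * (k + 1) = ∑ y ∈ dense, (k + 1) := by rw [sum_const, smul_eq_mul]
      _ ≤ ∑ y ∈ dense, 4 * N y := sum_le_sum fun y hy => (mem_filter.1 hy).2
      _ = 4 * ∑ y ∈ dense, N y := by rw [mul_sum]
      _ ≤ 4 * ∑ y, N y := Nat.mul_le_mul_left _ (sum_le_sum_of_subset (subset_univ _))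
      _ ≤ 4 * X.card := by rw [hsumN]; exact Nat.mul_le_mul_left _ hPc
  -- rows that are neither bad nor dense, and their complement
  set NG : Finset (Fin (k + 1)) := univ.filter fun y => ¬ (y ∉ badY ∧ y ∉ dense) with hNG
  have hNGc : NG.card * (k + 1) ≤ 5 * X.card := by
    have h1 : NG ⊆ badY ∪ dense := fun y hy => by
      rw [mem_union]
      have := (mem_filter.1 hy).2
      tauto
    have h2 := (card_le_card h1).trans (card_union_le _ _)
    have h3 : NG.card * (k + 1) ≤ badY.card * (k + 1) + dense.card * (k + 1) := by
      rw [← Nat.add_mul]; exact Nat.mul_le_mul_right _ h2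
    omega
  -- the core: free `z`-lines in good sparse rows
  set T : Finset (Fin (k + 1) × Fin (k + 1) × Fin (k + 1)) :=
    univ.filter fun v => (v.2.1 ∉ badY ∧ v.2.1 ∉ dense) ∧ (v.1, v.2.1) ∉ P with hT
  refine ⟨T, ?_, ?_⟩
  · -- counting: the complement of `T` lies in `A ∪ B`
    set A : Finset (Fin (k + 1) × Fin (k + 1) × Fin (k + 1)) :=
      univ.filter fun v => (v.1, v.2.1) ∈ P with hA
    set B : Finset (Fin (k + 1) × Fin (k + 1) × Fin (k + 1)) :=
      univ ×ˢ (NG ×ˢ univ) with hB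
    have hAc : A.card = P.card * (k + 1) := by
      have hAeq : A = (P ×ˢ (univ : Finset (Fin (k + 1)))).image
          fun q => (q.1.1, (q.1.2, q.2)) := by
        ext v
        simp only [hA, mem_filter, mem_univ, true_and, mem_image, mem_product, and_true,
          Prod.exists]
        constructor
        · intro hv
          exact ⟨v.1, v.2.1, v.2.2, hv, rfl⟩
        · rintro ⟨a, b, c, h, rfl⟩
          exact h
      rw [hAeq, card_image_of_injective, card_product, card_univ, Fintype.card_fin]
      rintro ⟨⟨a, b⟩, c⟩ ⟨⟨a', b'⟩, c'⟩ h
      simp only [Prod.mk.injEq] at h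
      obtain ⟨rfl, rfl, rfl⟩ := h
      rfl
    have hBc : B.card = (k + 1) * (NG.card * (k + 1)) := by
      rw [hB, card_product, card_product, card_univ, Fintype.card_fin]
    have hcov : (univ : Finset (Fin (k + 1) × Fin (k + 1) × Fin (k + 1))) ⊆ T ∪ (A ∪ B) := by
      intro v _
      rw [mem_union, mem_union]
      by_cases h1 : (v.1, v.2.1) ∈ P
      · exact Or.inr (Or.inl (mem_filter.2 ⟨mem_univ _, h1⟩))
      by_cases h2 : v.2.1 ∉ badY ∧ v.2.1 ∉ dense
      · exact Or.inl (mem_filter.2 ⟨mem_univ _, h2, h1⟩)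
      · refine Or.inr (Or.inr ?_)
        rw [hB, mem_product, mem_product]
        exact ⟨mem_univ _, mem_filter.2 ⟨mem_univ _, h2⟩, mem_univ _⟩
    have hcard := (card_le_card hcov).trans
      ((card_union_le _ _).trans (Nat.add_le_add_left (card_union_le _ _) _))
    rw [card_univ, Fintype.card_prod, Fintype.card_prod, Fintype.card_fin, hAc, hBc] at hcard
    -- arithmetic
    have hk : 0 < k + 1 := Nat.succ_pos k
    have e3 : (k + 1) ^ 3 = (k + 1) * ((k + 1) * (k + 1)) := by ring
    have e2 : (k + 1) ^ 2 = (k + 1) * (k + 1) := by ring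
    rw [e3]
    rw [e2] at hX
    have h1 : 16 * (P.card * (k + 1)) ≤ (k + 1) * ((k + 1) * (k + 1)) := by
      have := Nat.mul_le_mul_right (k + 1) (show 16 * P.card ≤ (k + 1) * (k + 1) by omega)
      linarith
    have h2 : 16 * ((k + 1) * (NG.card * (k + 1))) ≤ 5 * ((k + 1) * ((k + 1) * (k + 1))) := by
      have h2a : 16 * (NG.card * (k + 1)) ≤ 5 * ((k + 1) * (k + 1)) := by omega
      have := Nat.mul_le_mul_left (k + 1) h2a
      linarith
    have h3 : 0 < (k + 1) * ((k + 1) * (k + 1)) := by positivity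
    linarith
  · -- connectivity inside the core
    rintro ⟨vx, vy, vz⟩ hv ⟨wx, wy, wz⟩ hw
    simp only [hT, mem_filter, mem_univ, true_and] at hv hw
    obtain ⟨⟨hvy1, hvy2⟩, hvP⟩ := hv
    obtain ⟨⟨hwy1, hwy2⟩, hwP⟩ := hw
    -- free `x`-lines in the two rows
    have hcy : ∃ c, (vy, c) ∉ Pyz := by
      by_contra h
      exact hvy1 (mem_filter.2 ⟨mem_univ _, fun z => not_not.1 (not_exists.1 h z)⟩)
    have hcy' : ∃ c, (wy, c) ∉ Pyz := by
      by_contra h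
      exact hwy1 (mem_filter.2 ⟨mem_univ _, fun z => not_not.1 (not_exists.1 h z)⟩)
    obtain ⟨c, hc⟩ := hcy
    obtain ⟨c', hc'⟩ := hcy'
    have hNv : 4 * N vy < k + 1 := by
      by_contra h
      exact hvy2 (mem_filter.2 ⟨mem_univ _, not_lt.1 h⟩)
    have hNw : 4 * N wy < k + 1 := by
      by_contra h
      exact hwy2 (mem_filter.2 ⟨mem_univ _, not_lt.1 h⟩)
    -- a column index `x₀` good for both rows
    have hFc : (badX ∪ (((P.filter fun p => p.2 = vy).image Prod.fst) ∪
        ((P.filter fun p => p.2 = wy).image Prod.fst))).card <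
        (univ : Finset (Fin (k + 1))).card := by
      rw [card_univ, Fintype.card_fin]
      have h2 : (((P.filter fun p => p.2 = vy).image Prod.fst) ∪
          ((P.filter fun p => p.2 = wy).image Prod.fst)).card ≤ N vy + N wy :=
        (card_union_le _ _).trans (Nat.add_le_add card_image_le card_image_le)
      have h5 : 16 * badX.card ≤ k + 1 := by
        have e2 : (k + 1) ^ 2 = (k + 1) * (k + 1) := by ring
        rw [e2] at hX
        have : 16 * (badX.card * (k + 1)) ≤ (k + 1) * (k + 1) := by omega
        exact Nat.le_of_mul_le_mul_right (by linarith) (Nat.succ_pos k)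
      refine lt_of_le_of_lt (card_union_le _ _) ?_
      omega
    obtain ⟨x₀, -, hx₀⟩ := exists_mem_notMem_of_card_lt_card hFc
    rw [mem_union, mem_union, not_or, not_or] at hx₀
    obtain ⟨hx₀bad, hx₀v, hx₀w⟩ := hx₀
    have hx₀P : (x₀, vy) ∉ P := fun h =>
      hx₀v (mem_image.2 ⟨(x₀, vy), mem_filter.2 ⟨h, rfl⟩, rfl⟩)
    have hx₀P' : (x₀, wy) ∉ P := fun h =>
      hx₀w (mem_image.2 ⟨(x₀, wy), mem_filter.2 ⟨h, rfl⟩, rfl⟩)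
    have hcx : ∃ d, (x₀, d) ∉ Pxz := by
      by_contra h
      exact hx₀bad (mem_filter.2 ⟨mem_univ _, fun z => not_not.1 (not_exists.1 h z)⟩)
    obtain ⟨d, hd⟩ := hcx
    -- the walk: row `vy` to `x₀`, column `x₀` to row `wy`, row `wy` to the target
    exact avoid_trans (reach_row (zfree_of hvP) (zfree_of hx₀P) (xfree_of hc) vz 0)
      (avoid_trans (reach_col (zfree_of hx₀P) (zfree_of hx₀P') (yfree_of hd) 0 0)
        (reach_row (zfree_of hx₀P') (zfree_of hwP) (xfree_of hc') 0 wz))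

/-! ### Large connected sets avoiding few vertices; the tree-width bound -/

/-- **Deleting at most `m²/16` vertices from the `m × m × m` grid leaves a connected vertex set
with more than half of the vertices** (`m = k + 1`). The vertex-isoperimetric step of the
separator method [cite: SunilchandranKavitha2006, §4 (Lemma 7, the isoperimetric lower bound for
tree-width)]; the free-line count proving it here is elementary (see the module docstring). -/
theorem exists_isConnectedSet_disjoint_cubeGrid
    (X : Finset (Fin (k + 1) × Fin (k + 1) × Fin (k + 1))) (hX : 16 * X.card ≤ (k + 1) ^ 2) :
    ∃ K : Set (Fin (k + 1) × Fin (k + 1) × Fin (k + 1)),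
      IsConnectedSet (pathGraph (k + 1) □ (pathGraph (k + 1) □ pathGraph (k + 1))) K ∧
        Disjoint K ↑X ∧ (k + 1) ^ 3 < 2 * K.ncard := by
  obtain ⟨T, hTc, hT⟩ := exists_core X hX
  have hTne : T.Nonempty := by
    rw [← card_pos]
    have : 0 < (k + 1) ^ 3 := by positivity
    omega
  obtain ⟨a₀, ha₀⟩ := hTne
  refine ⟨{v | ∃ W : (pathGraph (k + 1) □ (pathGraph (k + 1) □ pathGraph (k + 1))).Walk a₀ v,
    ∀ p ∈ W.support, p ∉ X}, ?_, ?_, ?_⟩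
  · refine ⟨⟨a₀, hT a₀ ha₀ a₀ ha₀⟩, ?_⟩
    rintro u ⟨W₁, hW₁⟩ v ⟨W₂, hW₂⟩
    refine ⟨W₁.reverse.append W₂, fun z hz => ?_⟩
    rw [Walk.mem_support_append_iff, Walk.support_reverse, List.mem_reverse] at hz
    rcases hz with hz | hz
    · exact avoid_of_mem_support W₁ hW₁ hz
    · exact avoid_of_mem_support W₂ hW₂ hz
  · rw [Set.disjoint_left]
    rintro v ⟨W, hW⟩ hv
    exact hW v W.end_mem_support hv
  · have hsub : (↑T : Set (Fin (k + 1) × Fin (k + 1) × Fin (k + 1))) ⊆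
        {v | ∃ W : (pathGraph (k + 1) □ (pathGraph (k + 1) □ pathGraph (k + 1))).Walk a₀ v,
          ∀ p ∈ W.support, p ∉ X} := fun v hv => hT a₀ ha₀ v hv
    have h := Set.ncard_le_ncard hsub (Set.toFinite _)
    rw [Set.ncard_coe_finset] at h
    omega

/-- **The tree-width of the `m × m × m` grid is at least `w` whenever `16 w ≤ m²`** (`m = k + 1`;
the `d`-dimensional grid has tree-width `Θ(m^{d-1})`, here `d = 3` with an explicit constant):
the connected vertex sets with more than half of the vertices form a bramble that no `w` vertices
cover (`exists_isConnectedSet_disjoint_cubeGrid`), and brambles bound the tree-width from below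
(`le_treewidth_of_isBramble`). [cite: SunilchandranKavitha2006, §4 (Lemma 7: the separator /
isoperimetric lower bound `tw(G) ≥ min_{n/4 ≤ s ≤ n/2} b_v(s,G) - 1`, here in bramble form)] -/
theorem le_treewidth_cubeGrid {w : ℕ} (hw : 16 * w ≤ (k + 1) ^ 2) :
    w ≤ treewidth (pathGraph (k + 1) □ (pathGraph (k + 1) □ pathGraph (k + 1))) := by
  set ℬ : Set (Set (Fin (k + 1) × Fin (k + 1) × Fin (k + 1))) :=
    {B | IsConnectedSet (pathGraph (k + 1) □ (pathGraph (k + 1) □ pathGraph (k + 1))) B ∧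
      (k + 1) ^ 3 < 2 * B.ncard} with hℬ
  have hbr : IsBramble (pathGraph (k + 1) □ (pathGraph (k + 1) □ pathGraph (k + 1))) ℬ := by
    refine ⟨fun B hB => hB.1, fun B hB B' hB' => Or.inl ?_⟩
    by_contra hne
    rw [Set.not_nonempty_iff_eq_empty, ← Set.disjoint_iff_inter_eq_empty] at hne
    have h1 := Set.ncard_union_eq hne (Set.toFinite B) (Set.toFinite B')
    have h2 : (B ∪ B').ncard ≤ (Set.univ : Set (Fin (k + 1) × Fin (k + 1) × Fin (k + 1))).ncard :=
      Set.ncard_le_ncard (Set.subset_univ _) (Set.toFinite _)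
    rw [Set.ncard_univ, Nat.card_eq_fintype_card, Fintype.card_prod, Fintype.card_prod,
      Fintype.card_fin] at h2
    have h3 := hB.2
    have h4 := hB'.2
    have e3 : (k + 1) ^ 3 = (k + 1) * ((k + 1) * (k + 1)) := by ring
    omega
  refine le_treewidth_of_isBramble hbr fun Y hY hcov => ?_
  have hfin : Y.Finite := Y.toFinite
  have hYc : 16 * hfin.toFinset.card ≤ (k + 1) ^ 2 := by
    rw [hfin.encard_eq_coe_toFinset_card] at hY
    have : hfin.toFinset.card ≤ w := by exact_mod_cast hY
    omega
  obtain ⟨K, hK, hKX, hKc⟩ := exists_isConnectedSet_disjoint_cubeGrid hfin.toFinset hYc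
  rw [hfin.coe_toFinset] at hKX
  obtain ⟨v, hvK, hvY⟩ := hcov (show K ∈ ℬ from ⟨hK, hKc⟩)
  exact Set.disjoint_left.1 hKX hvK hvY

/-- The `/16` form: `⌊m²/16⌋ ≤ tw` of the `m × m × m` grid, `m = k + 1`.
[cite: SunilchandranKavitha2006, §4 (Lemma 7, separator method; `d = 3`)] -/
theorem sq_div_sixteen_le_treewidth_cubeGrid (k : ℕ) :
    (k + 1) ^ 2 / 16 ≤ treewidth (pathGraph (k + 1) □ (pathGraph (k + 1) □ pathGraph (k + 1))) :=
  le_treewidth_cubeGrid ((Nat.mul_comm _ _).trans_le (Nat.div_mul_le_self ((k + 1) ^ 2) 16))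

end CubeGrid

end Literature.Combinatorics.SimpleGraph
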